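import Mathlib

/-!
# Negative knowledge for crux `JParityClosure.OddContactSymmetry` (stmt-AtomisticToContinuum-13078):
# the untruncated reweighting blows up in the velocity tail; truncation vs J-symmetric cutoff

From the standing disprover's `Cruxes/OddContactSymmetry/Disproof.lean` §7 (refuter-cdisprove-stmt-AtomisticToContinuum-13078-0,
2026-08-16).  MECHANISM (prose there, numbers here in brief): along the Euler-scaled flow `(N+1)^{4/3}` collisions probe
pre-speeds `s² ≈ (8/3)θ log N`, while the `≍ N` velocities of an `r`-ball only reach `v_max² ≈ 2θ log N`; the Gaussian KDE
`hm` (bandwidth `ϑ`) at the pre-velocity of the deepest collisions is `∼ e^{−d²/2ϑ²}/N`, `d ≈ 0.2187√(θ log N)`, so the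
crux's untruncated weight `1 + e^{−F}` makes ONE collision contribute `T ≍ N^{0.02392·θ/ϑ² − 5/3}` — divergent for
`ϑ < 0.1198√θ` (`tail_blowup_exponent_pos`), at rung 0 (equilibrium) already.  The repair is a cutoff on the weight; the
two lemmas below say which: plain truncation `min(1+e^{−F}, L)` is NOT compatible with the inverse-collision parity even at
exact twisted balance (`truncation_breaks_parity`), whereas a common factor — an even function of the exactly J-odd
surprisal jump `F` — keeps the odd residual `ζ(ab′−a′b)(1/b+1/b′)` (`cutoff_reweighted_odd_residual`) and bounds the
weight (`cutoff_weight_bounded`).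
-/

namespace Summit.AtomisticToContinuum.HydrodynamicLimit.Theorems

namespace OddContactSymmetryNegative

/-- The blow-up exponent: with the nearest-sample estimate, one deepest-tail collision contributes
`T ≍ N^{0.02392·θ/ϑ² − 5/3}`, which diverges iff `ϑ² < 0.014352·θ`, e.g. for every `ϑ < 0.1198 √θ`.  (Arithmetic only;
the probabilistic content is in the module docstring above.) [folklore] -/
theorem tail_blowup_exponent_pos {θ ϑ : ℝ} (hϑ : 0 < ϑ) (h : ϑ ^ 2 < 0.014352 * θ) :
    0 < 0.02392 * θ / ϑ ^ 2 - 5 / 3 := by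
  have hϑ2 : 0 < ϑ ^ 2 := by positivity
  rw [sub_pos, lt_div_iff₀ hϑ2]
  nlinarith

/-- **Plain truncation is not J-compatible.**  Even at EXACT twisted balance `a b′ = a′ b` the truncated weights
`a·min(1 + b′/b, L)` and `a′·min(1 + b/b′, L)` differ: `a = b = 1`, `a′ = b′ = 4`, `L = 2` give `2 ≠ 5`.  So
`K_N[χ g Ψ min(1+e^{−F}, L)]` has a limit with a non-zero J-odd part wherever `F̄ ≠ 0`, of size `O(F̄)` near the
threshold. [folklore] -/
theorem truncation_breaks_parity :
    ∃ a a' b b' L : ℝ, 0 < b ∧ 0 < b' ∧ 1 ≤ L ∧ a * b' = a' * b ∧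
      a * min (1 + b' / b) L ≠ a' * min (1 + b / b') L := by
  refine ⟨1, 4, 1, 4, 2, one_pos, by norm_num, by norm_num, by norm_num, ?_⟩
  norm_num [min_eq_right, min_eq_left]

/-- **A J-symmetric cutoff preserves the parity structure.**  For any common factor `ζ` (in the crux: an even function of
the exactly J-odd surprisal jump `F`, e.g. `ζ_L(F) = max 0 (min 1 (L+1−|F|))`), the odd residual of the cut-off weight is
`ζ·(ab′ − a′b)(1/b + 1/b′)`: zero iff twisted balance, at every level `L`. [folklore] -/
theorem cutoff_reweighted_odd_residual (a a' b b' ζ : ℝ) (hb : b ≠ 0) (hb' : b' ≠ 0) :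
    a * ((1 + b' / b) * ζ) - a' * ((1 + b / b') * ζ) = ζ * ((a * b' - a' * b) * (1 / b + 1 / b')) := by
  field_simp
  ring

/-- The cutoff `ζ_L(F) = max 0 (min 1 (L+1−|F|))` is even in `F`, valued in `[0,1]`, `= 1` on `|F| ≤ L` and `= 0` on
`|F| ≥ L+1`; with it the weight is bounded: `(1 + e^{−F})·ζ_L(F) ≤ 1 + e^{L+1}`. [folklore] -/
theorem cutoff_weight_bounded (F L : ℝ) :
    (1 + Real.exp (-F)) * max 0 (min 1 (L + 1 - |F|)) ≤ 1 + Real.exp (L + 1) := by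
  by_cases h : L + 1 - |F| ≤ 0
  · have : max 0 (min 1 (L + 1 - |F|)) = 0 := by
      rw [max_eq_left]; exact le_trans (min_le_right _ _) h
    rw [this, mul_zero]; positivity
  · push Not at h
    have hF : -F ≤ L + 1 := by
      have := neg_abs_le F
      linarith
    have h1 : max 0 (min 1 (L + 1 - |F|)) ≤ 1 := max_le zero_le_one (min_le_left _ _)
    have h0 : 0 ≤ max 0 (min 1 (L + 1 - |F|)) := le_max_left _ _
    have hpos : 0 ≤ 1 + Real.exp (-F) := by positivity
    calc (1 + Real.exp (-F)) * max 0 (min 1 (L + 1 - |F|)) ≤ (1 + Real.exp (-F)) * 1 :=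
          mul_le_mul_of_nonneg_left h1 hpos
      _ ≤ 1 + Real.exp (L + 1) := by rw [mul_one]; gcongr

end OddContactSymmetryNegative

end Summit.AtomisticToContinuum.HydrodynamicLimit.Theorems
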